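import Mathlib
import HarnessLib
import HarnessLib.Audit
import Summits.ValiantsHypothesis.Statement
import Literature.Computability.AlgebraicComplexity.NewtonPolygonTauTransfer
import Literature.Computability.AlgebraicComplexity.ValiantConjectureProofs
import Summits.ValiantsHypothesis.ValiantsHypothesis.Theorems.NewtonUnitEquationsAssembly

/-!
Route: NewtonFrames

DORMANT since 2026-09-03T19:34:29Z (reconciler: no traction for 5 d (last activity item-evidence-added at 2026-08-29T18:41:08Z); parked, not closed — `ledger route dormant route-ValiantsHypothesis-NewtonFrames --off` to reactivate) — unstaffed, not closed; items shared with open routes are served there. `ledger route dormant <id> --off` reactivates.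

# Route NewtonFrames — Newton-polygon τ (KPTT), the coincidence half — additive relations among
exponent blocks, products minus points, shallow chains

It suffices to show X = NewtonTauWeak, KPTT's sufficient weak form of the τ-conjecture for Newton
polygons over ℂ
(KoiranEtAl2014 Conj. 1 / Thm 1): ∃ a b, every f = Σ_(i<k) Π_(j<m) f_ij with t-sparse bivariate f_ij
has a Newton
polygon with ≤ 2^(a·m)·(kt+2)^b vertices; KPTT Thm 1 (KpttTransfer) then gives per ∉ VP over ℂ with
free constants
and the proved hub gives VP_ℂ ≠ VNP_ℂ. X, KpttTransfer, TwoProducts and DissociatedUniform are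
SHARED by signature
with route NewtonUnitEquations (same X, alternative decomposition, D-0019): that route owns the
TENSOR half
(dissociated frames: unique exponent sums, cancellation = zero set of a rank-k tensor); this route
realises card
newton-polygon-freiman and owns the COINCIDENCE half — cancellation forced by additive relations Σ_j
d_j = 0 among
the exponent blocks — through two new ranked cruxes, ProductMinusPoints (one product minus |C|
points: KPTT's open
problems fg+1, f₁⋯f_m+1 are |C| = 1) and ShallowChains (its coefficient-free core: a Minkowski sum
of m t-sets minus
D points has poly(m,t,D) hull vertices), with a Freiman-type rigidity of direct Minkowski
factorisations as the
foreseen glue.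
Lean: `∃ a b : ℕ, ∀ (k m t : ℕ) (f : Fin k → Fin m → MvPolynomial (Fin 2) ℂ), (∀ i j, (f i
j).support.card ≤ t) → (Set.extremePoints ℝ (convexHull ℝ ((fun e : Fin 2 →₀ ℕ => fun i : Fin 2 =>
((e i : ℕ) : ℝ)) '' ((∑ i, ∏ j, f i j).support : Set (Fin 2 →₀ ℕ))))).ncard ≤ 2 ^ (a * m) * (k * t +
2) ^ b`

## Assembly
Pure logic over proved tree theorems, sorry-free in the planner's SketchTwo.lean (assembly_holds):
KpttTransfer applied
to X gives ¬IsVPFamily (perPoly · ℂ); the hub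
Summit.ValiantsHypothesis.Hub.valiantsHypothesis_of_not_isVPFamily_per
(Theorems/HubHub.lean) with the proved bridge mem_VP_ofFintype_iff_holds and perFamily_mem_VNP_holds
ℂ yields
ValiantsHypothesis. Same assembly term as route NewtonUnitEquations (shared). ProductMinusPoints,
ShallowChains,
TwoProducts, DissociatedUniform are necessary special cases / halves of X that stage its proof; not
antecedents.

Rationale: WHY THIS LINE. Lift f to a frame box B = Π_j A_j (A_j ⊇ supp f_ij) with the sum map π : B → ℕ²; f =
π_*(F) for the rank-k tensor
F = Σ_i ⊗_j f_ij and Newt(f) is an h.p.-shadow of Newt(F) (HrubesYehudayoff2021 Lemma 28). When π is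
injective
(dissociated frame) all cancellation is tensor cancellation — the sibling route's regime; when it is
not, the fibres
of π are additive relations Σ_j d_j = 0, d_j ∈ A_j − A_j, and a coefficient of f is a vanishing
FIBRE SUM: this is
the habitat of inverse sumset theory (TaoVu2006 Ch. 2, 5: Balog–Szemerédi–Gowers, Freiman;
dissociated sets;
rigidity of direct Minkowski factorisations à la de Bruijn's mixed-radix theorem) and of the
discrete geometry of
Minkowski sums (EPRS zbl:1160.52013, Bílka et al. zbl:1205.52010, Skomra–Thomassé arXiv:1903.11287),
neither of which
KPTT or HY21 bring to bear beyond convexly-independent-subset counting. The card's slogan 'cancel a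
lot and you are
an arithmetic progression' is kept but its cut is corrected (answering the novelty audit): pairwise
additive energy
is the wrong invariant — KPTT Ex. 3 digit blocks have zero coincidences yet a full-grid sum, and
T₁−T₂ on equal
blocks cancels with no additive coincidence — so structure-vs-randomness here is 'dissociated frame
vs relations
among blocks', and the minimal statement isolating relations is ONE product with a few support
points removed
(ProductMinusPoints), whose generic-coefficient case is pure geometry (ShallowChains: 'few
cancellations ⇒ few
vertices', the card's Lemma A made exact). Planner rungs recorded in NOTES.md (exchange lemma: k = 2
on a
dissociated frame has O(m²t²) vertices for all t; cube lemma of radius k−1, tight) agree with the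
sibling route's
sketch and are left to it. Versus other routes: TauConst counts roots and carries the constant gap;
X is root-free,
constant-free and implied by TauConst.TauReal (Hrubes2020Runners Prop 4), hence the most plausible
τ-type target on
the ledger; negatives index empty.

RANKED CRUXES. #0 NewtonTauWeak (target) — KPTT's weak Newton-polygon τ-conjecture over ℂ (shared
verbatim with route NewtonUnitEquations): vertices of Newt(Σ_(i<k) Π_(j<m) f_ij) ≤ 2^(a·m)(kt+2)^b
for t-sparse bivariate f_ij (vertices = extreme points of the convex hull of the support embedded in
ℝ²). (why it might fail: Open beyond k·t^(2m/3) (KPTT Thm 6); Example-3 digit grids hold t^(m/3)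
convexly independent candidates and k, t = poly(m) products with designed cancellations might carve
them; HY21 Cor 50: it forces σ(DS_n) ≤ 2^O(√n log² n), only 2^O(n) known.) [KoiranEtAl2014 Conj 1 +
Thm 1, HrubesYehudayoff2021 Conj 47 + Cor 50 + Open Problems 1-2, Hrubes2020Runners Prop 4]
#2 KpttTransfer (crux) — KPTT Theorem 1 (shared verbatim with route NewtonUnitEquations, where it is
support): the weak form implies that the permanent family over ℂ is not a VP family — via W_n =
Σ_(i<2^n) X^i Y^(i²-type) = h_n(X^(2^j), Y^(2^j)), Valiant's criterion, VNP-completeness of per, the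
proved depth-4 reduction (k, t = n^O(√n), m = O(√n)) and 2^n parabola vertices. Ranked 2 here as the
unproved printed fact gating the assembly (plancard rule); the mathematics is in ranks 3–6.
[difficulty: L] (why it might fail: Printed theorem (KPTT Thm 1, char 0, constants free); risk is
formal: Valiant's criterion for the squaring bit-language and depth-4 reduction by true degree must
port over ℂ WITH constants — if only the constant-free engine ports, the conclusion is ¬IsPBounded
τ(per) and needs TauConstElim.) [KoiranEtAl2014 Thm 1 + §3, Tavenas2015, Valiant1979, tree
RealTauConjectureViaVn.lean exists_sps_of_isProjection_perPoly, tree TavenasVnWitness.lean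
Tavenas2014_cor_3_37_of_BCS21_29, tree GateQuotients.lean DepthReduction.SLP.exists_sum_prod]
#3 ProductMinusPoints (crux) — Coincidence half, minimal form: ∃ c such that for ONE product T =
Π_(j<m) g_j of t-sparse bivariate complex polynomials and every finite C ⊂ ℕ², conv(supp T ∖ C) has
≤ (m+t+|C|+2)^c vertices. |C| = 0 is Ostrowski (≤ mt); C = {0} contains KPTT's open problems
Newt(fg+1) and Newt(f₁⋯f_m+1) (known O(t^(4/3)), k·O(t^(2m/3))); it is X at k = |C|+1 with all but
one product a monomial, so its whole difficulty is INTERNAL cancellation of one product, i.e.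
vanishing fibre sums over the additive relations among supp g_1, …, supp g_m. [deps: ShallowChains]
[difficulty: open-problem] (why it might fail: Internal cancellation hollows a product for free
((1−X)(1+X+⋯+X^(t−2)) = 1−X^(t−1)): a product of t-sparse factors supported on 'hull vertices + a
long convex chain one point deep', or a sparse Minkowski sum with (mtD)^ω(1) shallow points in
convex position, refutes it.) [KoiranEtAl2014 §5 + Thms 5-6 + Appendix Thm 7, zbl:1160.52013,
arXiv:1903.11287, TaoVu2006]
#4 ShallowChains (crux) — The coefficient-free core (card newton-polygon-freiman Lemma A, exact
form): ∃ c such that for t-sets A_0, …, A_(m−1) ⊂ ℕ², their Minkowski sum S (image of A_0 × ⋯ ×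
A_(m−1) under the sum map) and every finite C, conv(S ∖ C) has ≤ (m+t+|C|+2)^c vertices. It is
ProductMinusPoints for generic coefficients (then supp Π g_j = S); C = ∅ gives ≤ mt; every new
vertex is a point of S whose tangent cap lies in C ('depth ≤ |C|'), so the content is: shallow
points of a Minkowski sum in convex position are few. [difficulty: M] (why it might fail: A new
vertex p of S∖C only needs its tangent cap inside C: per direction there are C(m+D,D) rank profiles
of candidates, superpolynomial when m ≈ D; a direct sum of m sparse sets with a convex chain of
length (m+D)^ω(1) lying ≤ D points deep refutes it (grids give only D^(1/3)).) [zbl:1160.52013,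
zbl:1205.52010, arXiv:1903.11287, KoiranEtAl2014 Ex 3 + Lemma 2 + Prop 1, HrubesYehudayoff2021 Lemma
8]
#5 TwoProducts (crux) — k = 2 with arbitrary (coinciding) exponents (shared verbatim with route
NewtonUnitEquations): Newt(Π_(j<m) f_j − Π_(j<m) g_j) has ≤ 2^(a·m)(t+2)^b vertices — the first case
where tensor cancellation across the two products and coincidence cancellation inside each must be
combined; contains f₁⋯f_m + 1. [deps: ProductMinusPoints, DissociatedUniform] [difficulty: L] (why
it might fail: Open even for g ≡ 1 (KPTT §5: f₁⋯f_m+1; best k·t^(2m/3)); on non-aligned non-direct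
frames tensor and coincidence cancellation mix, each coefficient is a long fibre sum, and two signed
products on Example-3 digit grids might carve t^Ω(m) of the t^(m/3) convexly independent
candidates.) [KoiranEtAl2014 Thm 6 + Prop 1 + §5, HrubesYehudayoff2021 Open Problem 2,
arXiv:1903.11287] REGISTERED SKELETON OF RECORD for this item (stmt-ValiantsHypothesis-5906;
recorded by tenure g13 2026-08-28T17:24Z on director-valiant g14 R271 (2) «fold the v21 registration
into the next TwoProducts-side render» and the tenure_units grant forwarded by director-valiant g16
R279 (3); rationale text only — no item, kind, hold or `closes` change; on THIS route the ledger
kind of TwoProducts is `aside` since the gate's cone re-kind of 2026-08-27, the item itself is OPEN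
and shared, and its other wanting route NewtonUnitEquations is CLOSED (refuted:stmt-19542,
auto-close 2026-08-20) — so this block is where the record lives):
`Cruxes/TwoProducts/Lines/relation_ladder.lean` v21′ (tree sha16 898fa91404f6d89f, 1 418 lines; text
val-lit-p3 g16, written + registered by val-port-1 g2 16:42:12Z, val-lit STATUS 16:42:35Z; `ledger
skeleton check … --crux stmt-ValiantsHypothesis-5906` = «rc 0, errors 0, sorries 1 · skeleton: OK —
`…Cruxes.TwoProducts.RelationLadder.TwoProducts_holds_of_stubs` concludes
`…Theses.NewtonUnitEquations.TwoProducts`» (the shared decl; the NewtonFrames copy has the same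
normalised signature), REPLACING `Lines/FrameRungTwo.lean` as skeleton of record — of whose stubs
`stub_classHull` ✓ p579112 and `stub_faceCount` ✓ p580655 are landed theorems and
`stub_crossCancelCount` expired «not in skeleton 898fa91404f6»); composition
`TwoProducts_holds_of_stubs := twoProducts_of_planarCellBound (planarCellBound_v21 stub_permType
stub_relationClasses stub_rankOneSchema stub_residual)` in which `stub_permType : PermTypeLaw`,
`stub_relationClasses : RelationClassesLaw`, `stub_rankOneSchema : RankOneSchemaLaw` (R9,
`PermutationType.R9.rankOneSchemaLaw_proof`, val-lit-p3 g16 16:00:08Z «8/8 landed») and the earlier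
rungs R5/R6d/R7a/R7b/R7c are sorry-free theorems BY NAME from Theorems, and the ONE registered sorry
is `stub_residual : ResidualLawV21` = the LAW (val-idea-crit-3 g4 δ-READ ✓ 17:08:25Z of the v21′
bytes: sorries 1, `planarCellBound_v21` / `stub_rankOneSchema` std axioms, recomposition with `hres
: ResidualLawV21` in place of the stub std — «the only open input remains ResidualLawV21»; his v21
PASS carries over) — by the standing disprover's landed Negative files it is EQUIVALENT to
`PlanarCellBound` and survives every padding-stable side condition (✓ p650663
`Theorems/TwoProducts/Negative/FullPaddingResidual.lean :: residualV20_iff_planarCellBound`,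
`residualNoDatum_iff_planarCellBound`; ✓ p650855 `…/OneSidedPadding.lean`; ✓ p651205
`…/OneSidedPaddingResidual.lean :: residualV12_restricted_iff`, val-neg-1 g4/g5), i.e. the ladder
has CONFINED the crux to its residual, not shrunk it; R10 (positive-circuit chart, val-lit-p3 g16:
tool file ✓ p651158 `Theorems/NewtonUnitEquationsTwoProductsConfinedTameLawCircuits.lean`, chart
lemma in scratch) and WAVE-3 crux ideas (#34 minimal-gauge-normal-form, #35 presentation-bootstrap,
#37; critic val-idea-crit-8) are the live attacks on the residual and are cited here only as
activity, not as rungs. LABELS: skeleton registered ≠ item closed; 5906 `TwoProducts` OPEN as typed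
(one sorry = the law); 0 item status changes; VP≠VNP NOT proved. POINTER (tenure g13 last cycle
19:20Z, per director-valiant g16 R289 (1) «TwoProducts render pointer in your last cycle if it
fits»; records only): ★★ RUNG R10 DELIVERED AS A THEOREM — `ConfinedTameLaw C` CLOSED BY NAME FOR
EVERY C: ✓ p657736 `Theorems/NewtonUnitEquationsTwoProductsConfinedTameLawBridge.lean ::
…PermutationType.R10.confinedTameLaw_holds (C : ℕ) : R10Defs.ConfinedTameLaw C` (val-lit-p3 g16
18:37Z; Defs 808f0086701a115d = WAVE-3 idea-37 Sketch l.43–87 verbatim, val-idea-crit-8 block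
compare 8/8 and BY-NAME READS 18:35:30Z (Defs + bridge) / 18:41:48Z (`…ConfinedTameLawSliceCount ::
R10.sliceCountBound_holds`); engine ✓ p651158 `…ConfinedTameLawCircuits` + ✓
p652420/p653306/p654006/p654429/p654850 + Count/Arith files) — the first rung of the g16 seat
delivered as a theorem (minted R275 as rung-candidate, closed ∀ C at 18:37Z; D-0050 «rungs are
theorems»); its HONEST COMPLEMENT is also kernel: ✓ p654184 + ✓ p658893
`Theorems/TwoProducts/Negative/TowerPaddingR10.lean :: residualNotTameR10_iff_planarCellBound (C)`
(val-neg-1 g5) — the post-R10 residual is padding-equivalent to the full planar cell bound: R10 is a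
genuine proper sub-case and its complement is the whole problem again (same shape as the v20/v21
residual records above). WAVE-3 RESULT OF RECORD (crit-8 FINAL KEEP/KILL 18:51:37Z, registered R289
(1)): KEEP 6 (PASS 2 · PASS-WITH-PRICE 3 · PASS-obstruction 1) / KILL 1 (X1
`minimal-gauge-normal-form`, by its own falsifier: an M2-respecting S-preserving planting exists ⇒
V22Shape ⟺ CellLaw) / FOUND-NOTHING 2 memos (idea-35 #2, idea-33 accepted-with-map); consequences
booked there: K4 `submerged-band-filtration` → a short INFRASTRUCTURE rung «WLOG submerged» (stop
there absent an engine for the flat low band; `SubmergedFlatLaw` typed as P1), K5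
`cancellation-jacobian-rank` = S⁺ target, no seat until P2, K6 `factor-gauge-rigidity` K1 →
Negative-lane landing by val-neg-1 g5 (v22 then says `stub_residual` IS the bare per-cell law;
TYPING RULE «presence-type residual hypotheses are inert» adopted ladder-wide for 5906), p3's
after-R10 memo (engine family STOPS at R10; (D1) towers-are-radix / (D2) wide-support tensorisation
= WAVE-5 seed material). SKELETON: v22 of `Cruxes/TwoProducts/Lines/relation_ladder.lean` (registers
R10 CLOSED-BY-NAME; text val-lit-p3 g16 18:51:12Z stage, crit-8 v22 δ-READ ✓ 18:52:32Z, pen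
val-port-1 g3, desk #326 GO-on-silence 19:03Z): ★ REGISTERED 19:04:24Z @a14f3e2358cb (val-port-1 g3;
tree sha16 581d40c40452635e = p3 g16's staged bytes verbatim; val-neg-1 g5 NO OBJECTION 18:58:12Z,
crit-3/crit-8 silent to 19:03Z; `ledger skeleton check … --crux stmt-ValiantsHypothesis-5906` OK
19:04:14Z — `…Cruxes.TwoProducts.RelationLadder.TwoProducts_holds_of_stubs` concludes
`…Theses.NewtonUnitEquations.TwoProducts`, closed = False; registered stubs on stmt-5906 =
{`stub_residual : ResidualLawV22`} (sorries 1; the residual re-typed ∃C-outermost),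
`stub_confinedTame : ∀ C, R10Defs.ConfinedTameLaw C := R10.confinedTameLaw_holds` CLOSED BY NAME,
composition `planarCellBound_v21 … (residualLawV21_of_V22 stub_residual stub_confinedTame)`;
evidence #45; director R290 (4) «RUNG R10 REGISTERED ON THE LINE»; sketches
`Lines/relation_ladder_sketch_R11.lean` @8b0c5b58039a / `…_sketch_R10.lean` @39e10f326e14) — v22
superseded v21′ and is itself superseded by v23 (next). ★★ RUNG R11 (STAGE 1) DELIVERED
(director-valiant g16 R291 (1), 19:20:57Z; merged desk g14 BOOKED 19:24Z): ✓ p660616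
`Theorems/NewtonUnitEquationsTwoProductsRaySplitLaw.lean :: …PermutationType.R11.raySplitLaw_holds :
RaySplit.RaySplitLaw` + `…R11.raySplitCellLaw_holds : RaySplit.RaySplitCellLaw`, over ✓ p659961
`…RaySplitLift` + ✓ p660296 `…RaySplitSpan` + defs ✓ p657870 `…RaySplitDefs` (val-lit-p3 g16 writer,
all four pressed under desk #328 (a) option α, `--supports 5906 --as helper`, std axioms; append ✓
p662017 `raySplitCellBound`; Stage-2 engine piece ✓ p661962 `…RaySplitExpPolyShift :: expPoly_shift`
(p3 FINAL 19:44Z: 27 files today); δ-read PASS val-port-3 g2 19:09:37Z; crit-8 BY-NAME READ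
19:10:02Z and by-name PASS on the defs 18:40:40Z; also ✓ p659234 `…ConfinedTameLawSliceCount ::
R10.sliceCountBound_holds`, R10 sketch 100 % in tree) — WHAT IS NOW A THEOREM: letters on K rays
(`OnRays`) with no cross-ray coincidence (`RayCrossFree`) ⇒ #visible ≤ 2^{(m+1)K} and every cell
family #S ≤ 2^{(m+1)K}, t-FREE, any in-ray rank (digits, torsion, carries on a ray); `IndepRays`
unused (note of record); HOW: Freiman ray-splitting lift `phiT M (liftG cU cV)` (no new engine),
Freiman injectivity on realised tuple sums, coefficient-span lemma; like R10 (minted 15:5xZ → ∀ C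
18:37Z, complement = the planar cell bound again ✓ p658893) it is a PROPER POSITIVE SUB-CASE (K sits
in the exponent) — the second rung of the g16 seat delivered as a theorem (rung-candidate R282
17:3xZ → typed 18:39Z → theorem 19:20Z). ★ v23 = REGISTERED SKELETON OF RECORD (val-port-1 g3 pen:
`crux write` 19:31:27Z on δ-silence per R291 (1) → `Cruxes/TwoProducts/Lines/relation_ladder.lean`
@f0f1465b7f24, tree sha16 0d5180bfe433d700 = val-lit-p3 g16's staged candidate
`lmr/staged/p3g16-v23/relation_ladder_v23_candidate.lean` VERBATIM (1 556 l.); δ-reads val-neg-1 g5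
NO OBJECTION 19:29:50Z, crit-8 g0 close note without objection, crit-3 g4 silent; `ledger skeleton
check … --crux stmt-ValiantsHypothesis-5906` OK 19:35Z —
`…Cruxes.TwoProducts.RelationLadder.TwoProducts_holds_of_stubs` concludes
`…Theses.NewtonUnitEquations.TwoProducts`, closed = False; registered stubs on stmt-5906 =
{`stub_residual : ResidualLawV23`}, sorries 1; evidence #46): v22 + `import …RaySplitLaw`; `theorem
stub_raySplit : RaySplit.RaySplitCellLaw := PermutationType.R11.raySplitCellLaw_holds` CLOSED BY
NAME (beside R10's `stub_confinedTame := R10.confinedTameLaw_holds`, ∀ C); `def ResidualLawV23` =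
the V22 residual (hypotheses verbatim incl. ¬confined-tame at C) with the extra hatch ¬(∃ K ≤ C, ∃ g
ι ν, `RaySplit.IndepRays g ∧ RaySplit.OnRays g ι ν (tailSupport u v) ∧ RaySplit.RayCrossFree ι A`) —
K bounded by the SAME prover-chosen C, as val-neg-1's pre-audit required; glue
`residualLawV23_of_V22` / `raySplit_arith : 2^((m+1)K) ≤ 2^(Cm)(t+2)^C (K ≤ C)` /
`residualLawV22_of_V23` PROVED; composition `twoProducts_of_planarCellBound (planarCellBound_v21
stub_permType stub_relationClasses stub_rankOneSchema (residualLawV21_of_V22 (residualLawV22_of_V23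
stub_residual stub_raySplit) stub_confinedTame))`. LABEL OF RECORD for the one sorry (val-neg-1 g5
Negative lane, kernel-checked in scratch 19:28Z — `lmr/staged-neg1g5-CheckT8-scratch.lean` sha16
b9b412b5e8a642c8 rc 0 / 0 sorry; DEFEQ scratch vs the candidate's `def ResidualLawV23` verbatim rc 0
19:29Z; ✓✓ LANDED T8 (val-neg-1 g5, val-lit STATUS 19:52:06Z): ✓ p661910
`Theorems/TwoProducts/Negative/DirectionsPadding.lean` (`not_raySplit_of_directions`,
`directions_padding`, `isCellFamily_append_common_below`; 19:41Z) + ✓ p662518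
`Theorems/TwoProducts/Negative/RaySplitResidual.lean ::
Summit.ValiantsHypothesis.Theorems.TwoProducts.Negative.RaySplitResidual.residualV23_iff_planarCellBound`
(19:51Z; + `planarCellBound_of_residualNotRaySplit (C)`, `residualNotRaySplit_iff_planarCellBound
(C)`, `planarCellBound_of_residualV23`; usable in the line file as `by unfold ResidualLawV23
ClassCover HasDatum; exact residualV23_iff_planarCellBound`)): ★ `residualV23_iff_planarCellBound` —
for each fixed C, «ResidualLawV23» ⟺ «PlanarCellBound» ((a,b) ↦ (a(18C+27), …)) via
`not_raySplit_of_directions` (C+1 pairwise non-parallel COMMON letters ⇒ no `OnRays` structure with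
K ≤ C, pigeonhole on ι) + `directions_padding` (m ↦ m+C+1, same logDiff, same cells) — so
`stub_residual : ResidualLawV23` IS STILL THE LAW (= PlanarCellBound), exactly as for v21 (✓
p650663/p650855/p651205, ✓ p654184/p658893) and v22 (★ ✓ p660030 `Negative/ResidualV22 ::
residualV22_iff_planarCellBound` — the v22 residual is padding-complete; director R292 (3) «the V23
label is neg-1's next file against the tree text»). crit-8: Stage 2 (bounded-value rays + free
letters, `ExpPolyPencilCount`) PASS-WITH-PRICE — type against `ShiftRank.pencilCount` first; no seat
tonight (R291 (1)). NEXT 5906 PROVER HAND (merged desk RULING #333 19:56:04Z, per director-valiant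
g16 R289 (1) «next hand after R11 Stage 1»): val-lit-p3 g17 CLAIM K4 `submerged-band-filtration`
INFRASTRUCTURE RUNG («WLOG submerged») GO AS CLAIMED — (A1)
`Theorems/NewtonUnitEquationsTwoProductsSubmergedDefs.lean` (defs verbatim from val-idea-36 g0
Sketch.lean l.22–77), (A3) `submergedReduction_holds : SubmergedReduction` SIG-FIRST to val-neg-1 g5
/ crit-8 g2 / pen val-port-1 g3 (K4 is an EQUIVALENCE `CellLaw ⇐ SubmergedCellLaw at (a+1,b+1)`, so
the residual label of record stays «= PlanarCellBound as a law»), NO δ-wire into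
`Lines/relation_ladder.lean` by p3 (whether a v24 threads `IsSubmergedCellFamily` into the residual
hypothesis is the pen's + neg-1's call AFTER (A3) lands; TYPING RULE R289: presence-type hypotheses
are inert, a WLOG-type hypothesis is admissible only with the proved reduction cited by name).
LABELS: rungs closed by name ≠ item closed; 5906 `TwoProducts` OPEN as typed (one sorry = the law ≡
`PlanarCellBound` modulo padding); item kind on this route = aside; 0 item status changes; VP≠VNP
NOT proved.
#6 DissociatedUniform (crux) — The tensor half (shared verbatim with route NewtonUnitEquations, rank
2 there): on a dissociated frame (supp f_ij ⊆ A_j, |A_j| ≤ t, sum map injective on A_0 × ⋯ ×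
A_(m−1)) Newt(Σ_i Π_j f_ij) has ≤ (kmt+2)^C vertices; wanted here because the synthesis glues it to
ProductMinusPoints through a coincidence budget. [difficulty: open-problem] (why it might fail:
Shared tensor half (route NewtonUnitEquations): for large k the ψ-maximiser can sit k−1 coordinate
changes from the frame maximiser (cube lemma tight), and by HY21 Thm 4 the count is a parametric
breakpoint number — Carstensen-type gadgets or root-of-unity designs might force (kmt)^ω(1).)
[KoiranEtAl2014 Ex 3 + Prop 1, HrubesYehudayoff2021 Thm 4 + Lemma 28 + Prop 49 + Remark 48,
doi:10.1006/jcss.2001.1766]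

TWO-LAYER PLAN. Foreseen glued splits (none filed; k ≤ 3, depth 1). NewtonTauWeak ⇐
DissociatedRobust (dissociated frame minus D
points, poly(k,m,t,D)) → OverlapRigidity (two direct frames whose sumsets share ≥ |S|/K points align
on sub-frames
up to poly(K,m,t) loss, modulo common mixed-radix refinement — cf. [0,8) = {0,1,4,5}+{0,2} =
{0,2,4,6}+{0,1}; the
card's Freiman-type inverse theorem, correctly placed) → NewtonTauWeak. ProductMinusPoints ⇐
ShallowChains →
TopRelations (relations Σ_j d_j = 0 among ψ-top differences of the blocks are Freiman-rigid: many
relations near the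
hull force a common short progression, few relations reduce to ShallowChains) → ProductMinusPoints.
TwoProducts ⇐
FibreSums (which fibre sums Σ_(a∈fibre)(Πc − Πc') vanish: cosets where the products agree
identically + sporadic)
→ ProductMinusPoints-type peeling → TwoProducts.

KILL CRITERIA. ShallowChains refuted ⇒ ProductMinusPoints and X's polynomial form die with it unless
the witness needs |C| beyond
2^O(m)·poly: close `refuted:ShallowChains` if the witness has |C| ≤ poly(m,t) and superpolynomially
many vertices
with 2^o(m) slack exhausted, else restate both coincidence cruxes in the weak shape
2^(a·m)(t+|C|+2)^b (pivot, one
edit). ProductMinusPoints or TwoProducts refuted within the weak shape ⇒ X false ⇒ close refuted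
(and the sibling
route breaks on the shared item). σ(DS_n) = 2^Ω(n) (HY21 Open Problem 1) refutes X via Prop 49 ⇒
close refuted.
TauConst.TauReal proved ⇒ X follows (Hrubes2020Runners Prop 4) ⇒ close superseded.
DissociatedUniform refuted but X
alive ⇒ drop it here (not load-bearing for the coincidence half) and follow the sibling's
restatement.

NOT DECOMPOSED YET. The synthesis for general k (trivial lift ⊔_i B_i, grouping products into
aligned families by overlap rigidity,
coincidence budget feeding DissociatedRobust) — the thesis' gluing, a third layer today; the precise
OverlapRigidity
statement; the polynomial form of KPTT Conj 1 ((kmt)^O(1), printed conjecture; X is the weak form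
the summit
needs — the coincidence cruxes are already polynomial); the powers form of KPTT Thm 3 (Σ a_i g_i^m
on an
m-dissociated common support = k-term exponential sums on the discrete simplex; k = 2 gives O(t²)
vertices); the
planner's k = 2 all-t dissociated rung with zeros allowed (exchange lemma, NOTES.md) — offered to
provers of the
sibling's DissociatedFixedK as a `--supports` lemma rather than filed twice.

CHEAPEST FALSIFIER. ShallowChains is finite geometry and the cheapest thing to break: kit search
over direct digit-type and random
frames (m ≤ 16, t ≤ 4) removing the D ≤ 2m shallowest points greedily / by simulated annealing to
maximise hull
vertices of S ∖ C; growth faster than (m·D)^2 is alarming, a clean (m+D)^ω(1) family kills ranks 3–4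
(not run
here: one-shot planner seat, hub compute-free). Second: ProductMinusPoints at |C| = 1 — products of
m ≤ 12
trinomials with engineered internal cancellation (cyclotomic-type factors), constant term removed.
Lookups done and
consistent: KPTT App. Thm 7 (same-support fg+1 linear), HY21 Prop 15 (hypersimplex shadows ≤ n²),
Remark 48
(monotone ≤ kmt); sibling's smoke test (dissociated cube, ≈ 2m vertices flat in k).

NUMBERS. Known: ≤ k·O(t^(2m/3)) edges (KoiranEtAl2014 Thm 6); M_2(t) = Θ(t^(4/3)) (zbl:1160.52013,
zbl:1205.52010), M_m(t) ≥
t^(m/3) (KPTT Prop 1); fg+1 ≤ t+1 edges under same-support hypotheses (KPTT App. Thm 7); transfer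
needs
2^((m+log kt)^c), c < 2 (Thm 1); hard instance: 2^n vertices vs k, t = n^O(√n), m = O(√n); σ(DS_n) ∈
[2^Ω(log² n),
2^O(n)] (HY21 Prop 23); grids: a convex lattice chain of length L ≤ D points deep needs D ≳ L³/6 (so
ShallowChains
holds with exponent 1/3 on grids); exchange lemma k = 2: ≤ 2mt(mt+3) vertices. Items at open: 7 (1
target,
5 cruxes of which 3 shared, 1 assembly).

DEFINITION REQUESTS. None. Vertex count inlined as `(Set.extremePoints ℝ (convexHull ℝ (supp
embedded in Fin 2 → ℝ))).ncard` exactly as in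
route NewtonUnitEquations (so items dedup); Minkowski sum written `(Fintype.piFinset A).image (fun a
=> ∑ j, a j)`.
A Literature def `newtonVertexCount` with Ostrowski/finiteness API is worth a `--supports` lemma
file, not an item.

Novelty: Searches (2026-08-15): `lit search` local ×2 (search daemon: connection reset), `--source
openalex|s2|arxiv` (HTTP 429),
`--source zbmath` ×8 ("Newton polygon sparse polynomials sums of products" → SoCG'15 proc. only;
"convexly independent
subsets Minkowski sum" → EPRS08 zbl:1160.52013, Skomra–Thomassé arXiv:1903.11287, Bílka et al.
zbl:1205.52010;
"lower bound shortest path problem Mulmuley Shah" → doi:10.1006/jcss.2001.1766; "shadows of Newton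
polytopes" → HY21
CCC + Isr. J. Math. 2023; "distribution of runners on a circle" → arXiv:1906.02511; 3 further
queries 0 hits);
`lit vsearch` ×1 (no relevant held text); `lit galaxy search --star all` ×1 (queue saturated),
`--star pdf "Shadows of
Newton polytopes"` (2 hits: Chatterjee–Gajjar–Tengse ECCC TR22-031 revisions only); full texts read:
arXiv:1308.2286
(KPTT), HrubesYehudayoff2021 (DROPS PDF pp. 1–23), arXiv:1906.02511; `ledger negatives` (0); sibling
cards
newton-polygon-unit-equations, ultrametric-sps-tau, newton-vertex-count-one-prime and routes
TauConst/Depth4 read.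
Nearest prior art found: KoiranEtAl2014 (the direct convexity engine Thms 4–6, digit example, open
problems);
HrubesYehudayoff2021 (shadow complexity = parametric complexity Thm 4, h.p.-projections Lemma 28,
Prop 49/Cor 50,
monotone Remark 48, Open Problems 1–2); Hrubes2020Runners Prop 4 (real τ ⇒ Newton τ); card
newton-polygon-unit-equations (multiplicative structure of cancellation sets, (2,2) rung).
Delta: the frame dichotomy — faithful shadows of rank-k t  [refs: 10.1006/jcss.2001.1766, 1903.11287, 1906.02511, 1308.2286, doi:10.1006/jcss.2001.1766, HrubesYehudayoff2021, KoiranEtAl2014]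

Barriers (technique_class: newton-polygon-tau, additive-combinatorics, shadows): - technique_class: newton-polygon-tau, additive-combinatorics, shadows
- Literature.Barriers.ValiantsHypothesis.TauRealZeros: not engaged — nothing counts zeros (Chebyshev
T_(2^k) has a 2-vertex Newton polygon), and NewtonTau is implied by the SPS-restricted real
τ-conjecture (Hrubes2020Runners Prop 4), i.e. it lies on the catalogued evasion side 'restrict the
circuits, not the zeros'.
- Literature.Barriers.ValiantsHypothesis.MonotoneGap: the monotone case of every crux is trivial
(HY21 Remark 48: ≤ kmt vertices) and nothing is transferred monotone ⇒ general: cancellation is the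
object, split into tensor cancellation (DirectFrames) and coincidence cancellation
(ProductMinusPoints); honest caveat — support counting fails exactly where internal cancellation
hollows supports for free, which is why ProductMinusPoints is a ranked crux, not support.
- Literature.Barriers.ValiantsHypothesis.PermanentCharTwo: the transfer and all statements are over
ℂ (KPTT Remark 1: char ≠ 2, or HC instead of per in char 2); no field-uniform claim.
- Literature.Barriers.ValiantsHypothesis.DepthReductionChasm: depth reduction is used only inside
the printed transfer (Tavenas bounds as they are), on the 'use the chasm' side; no improved
reduction or VP-saturated measure is posited.
- Literature.Barriers.ValiantsHypothesis.AlgebraicNaturalProofs: no polynomial distinguisher on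
coefficient vectors; 'few shadow vertices' is a combinatorial property of supports, neither
constructive-large nor a rank measu

Novelty grade: new-combination — ROUTE REVIEW (refuter rreview cdf7e025, 2026-08-15). VERDICT: keep open; one hygiene repair; new-combination fair (KPTT open problems recast as 'one product minus |C| points' with a coefficient-free Minkowski-sum core + inverse-sumset glue — in none of the sources reached; searchd down, zbMATH only) (refuter refuter-rreview-route-Schanuel-KFunction-cdf7e025-0, 2026-08-15T13:57:02Z; prior: arXiv:1308.2286 (KPTT: Conj 1, Thm 1, Thms 5-6, Ex 3, §5 open problems), HrubesYehudayoff2021 (shadows of Newton polytopes), zbl:1160.52013 (EPRS), zbl:1205.52010 (Bílka et al.), arXiv:1903.11287 (Skomra–Thomassé), TaoVu2006, route-ValiantsHypothesis-NewtonUnitEquations (open sibling, shares X + 4 items))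

History (route lifecycle, newest last):
- 2026-08-15T12:03:44Z · rev 1: restated NewtonTau (stmt-ValiantsHypothesis-6687), KpttTransfer (stmt-ValiantsHypothesis-6688), DirectFrames (stmt-ValiantsHypothesis-6689), TwoProducts (stmt-ValiantsHypothesis-6691), Assembly (stmt-ValiantsHypothesis-6693) — plancard pivot: sibling route NewtonUnitEquations (opened 11:53) owns the tensor half; (planner-plancard-ValiantsHypothesis-ValiantsH-92318e3d-0)
- 2026-08-15T12:03:44Z · rev 1: dropped DirectFramesTwo, HubPerNotVp — plancard pivot: sibling route NewtonUnitEquations (opened 11:53) owns the tensor half; this route now owns the coincidence half of card newton-polygon-freiman. (planner-plancard-ValiantsHypothesis-ValiantsH-92318e3d-0)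
- 2026-08-16T02:18:11Z · AUTO-CRUX: 1 conjecture-grade item(s) promoted to crux (NewtonTauWeak) — refuter vetting / tiering apply (operator:999:1362873)
- 2026-08-16T04:21:15Z · AUTO-CRUX (backfill): NewtonTauWeak — hypotheses of the deciding theorem that nothing in the route derives are cruxes (operator:999:1085951)
- 2026-08-25T09:53:54Z · DORMANT — reconciler: no traction for 7.6 d (last activity item-evidence-added at 2026-08-17T19:09:50Z); parked, not closed — `ledger route dormant route-ValiantsHypothes (operator:999:2149502)
- 2026-08-27T08:47:34Z · REACTIVATED — reconciler: reactivated — activity statement-closed at 2026-08-27T07:20:49Z after parking at 2026-08-25T09:53:54Z (operator:999:1659466)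
- 2026-09-03T19:34:29Z · DORMANT — reconciler: no traction for 5 d (last activity item-evidence-added at 2026-08-29T18:41:08Z); parked, not closed — `ledger route dormant route-ValiantsHypothesis (operator:999:4060656)

sub-problem: ValiantsHypothesis · status: dormant · opened planner-plancard-ValiantsHypothesis-ValiantsH-92318e3d-0 2026-08-15T11:50:26Z · rev 6 · ledger route-ValiantsHypothesis-NewtonFrames
GENERATED by the gate from the ledger (D-0016/17). Provers cite these decls: `theorem foo : Summit.ValiantsHypothesis.ValiantsHypothesis.Theses.NewtonFrames.<Decl> := …` in Summits/ValiantsHypothesis/ValiantsHypothesis/Theorems/<Name>.lean.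
-/

namespace Summit.ValiantsHypothesis.ValiantsHypothesis.Theses.NewtonFrames

open scoped BigOperators Topology Manifold Classical MeasureTheory ProbabilityTheory Matrix InnerProductSpace ComplexConjugate ContinuousMap
open Filter Set Function TopologicalSpace MeasureTheory

attribute [summit_statement] _root_.ValiantsHypothesis

open Literature.PNP

/-- item stmt-ValiantsHypothesis-5904 · crux (kind.auto-crux: conjecture-grade) · rank 0 · open · by planner
why it might fail: Open beyond k·t^(2m/3) (KPTT Thm 6); 'believed to be false' (Chatterjee–Gajjar–Tengse 2023 Conj 1.3), HY21 shadows as a refutation programme: digit grids hold t^(m/3) convexly independent candidates; via HY21 Cor 50 it forces σ(DS_n) ≤ 2^O(√n log² n), only 2^O(n) known.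
sources: KoiranEtAl2014 Conj 1 + Thm 1, HrubesYehudayoff2021 Conj 47 + Cor 50 + Open Problems 1-2, Hrubes2020Runners Prop 4, ChatterjeeGajjarTengse2022 Conj 1.3
[target] KPTT's sufficient weak form of the Newton-polygon τ-conjecture: vertices of Newt(Σ_(i<k)
Π_(j<m) f_ij) ≤ 2^(a·m)(kt+2)^b for t-sparse bivariate f_ij over ℂ (vertices = extreme points of the
convex hull of the support in ℝ²). -/
@[route_item "route-ValiantsHypothesis-NewtonFrames"]
def NewtonTauWeak : Prop :=
  ∃ a b : ℕ, ∀ (k m t : ℕ) (f : Fin k → Fin m → MvPolynomial (Fin 2) ℂ), (∀ i j, (f i j).support.card ≤ t) → (Set.extremePoints ℝ (convexHull ℝ ((fun e : Fin 2 →₀ ℕ => fun i : Fin 2 => ((e i : ℕ) : ℝ)) '' ((∑ i, ∏ j, f i j).support : Set (Fin 2 →₀ ℕ))))).ncard ≤ 2 ^ (a * m) * (k * t + 2) ^ b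

-- earlier KpttTransfer (stmt-ValiantsHypothesis-6688, replaced 2026-08-15T12:03:44Z -> stmt-ValiantsHypothesis-5909): retired by None — (∃ c : ℕ, ∀ (k m t : ℕ) (f : Fin k → Fin m → MvPolynomial (Fin 2) ℂ), (∀ i j, (f i j).support.card ≤ t) → (Set.extremePoints ℝ (convexHull ℝ ((fun e : Fin 2 →₀ ℕ => fun l : Fin 2 => ((e l : ℕ) : ℝ)) '' ((∑ i, ∏ j, f i j).support : Set (Fin 2 →₀ ℕ))))).ncard ≤ 2 ^ (c
/-- item stmt-ValiantsHypothesis-5909 · support · rank 2 · closed · proved by Summit.ValiantsHypothesis.ValiantsHypothesis.Theorems.kpttTransfer_proof @ aaf66cee0494 (prover) · by planner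
why it might fail: Printed theorem (KPTT Thm 1, char 0, constants free); risk is formal: Valiant's criterion for the squaring bit-language and depth-4 reduction by true degree must port over ℂ WITH constants — if only the constant-free engine ports, the conclusion is ¬IsPBounded τ(per) and needs TauConstElim.
sources: KoiranPortierTavenasThomasse2015, Thm 1, tree: Literature.Computability.AlgebraicComplexity.KPTT.theorem1_holds
[support] KPTT Thm 1 (theorem in print; X inlined): the weak Newton-polygon τ-conjecture implies
that (per_n) is not a VP family over ℂ (constants unrestricted). Proof to formalise = KPTT §3 with
the tree's machinery: witness W_n(X,Y) = Σ_(i<2^n) X^i Y^(2i(2^n−1−i)) = aeval(x_j ↦ X^(2^j), z_l ↦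
Y^(2^l)) (TavenasVn.hV ℂ n) — 2^n points on a strictly concave parabola, all vertices; hV is a
projection of PER_q(n) (TavenasVn.isProjection_boolSum_eval with BCS1997_thm_21_27/29_holds ℂ);
under IsVPFamily per, complexity(hV) = n^O(1), and the proved depth-four reduction
(DepthReduction.SLP.exists_sum_prod, as in exists_sps_of_isProjection_perPoly but over ℂ with
`complexity`) writes W_n as Σ^k Π^m of t-sparse polynomials with k, t ≤ (n+2)^(C√n), m ≤ C√n; then
2^(aC√n)((n+2)^(2C√n)+2)^b < 2^n for large n (cf. exists_pow_sqrt_lt_two_pow). [difficulty: M] -/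
@[route_item "route-ValiantsHypothesis-NewtonFrames"]
def KpttTransfer : Prop :=
  (∃ a b : ℕ, ∀ (k m t : ℕ) (f : Fin k → Fin m → MvPolynomial (Fin 2) ℂ), (∀ i j, (f i j).support.card ≤ t) → (Set.extremePoints ℝ (convexHull ℝ ((fun e : Fin 2 →₀ ℕ => fun i : Fin 2 => ((e i : ℕ) : ℝ)) '' ((∑ i, ∏ j, f i j).support : Set (Fin 2 →₀ ℕ))))).ncard ≤ 2 ^ (a * m) * (k * t + 2) ^ b) → ¬ Literature.Computability.AlgebraicComplexity.IsVPFamily (fun n => Literature.Computability.AlgebraicComplexity.perPoly (Fin n) ℂ)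

-- `KpttTransfer` holds: proved by `Summit.ValiantsHypothesis.ValiantsHypothesis.Theorems.kpttTransfer_proof` @ aaf66cee0494 (its module imports this route file, so no `_holds` link can be stated here).

/-- item stmt-ValiantsHypothesis-5905 · aside · rank 3 · open · by planner
why it might fail: Shared tensor half (route NewtonUnitEquations): for large k the ψ-maximiser can sit k−1 coordinate changes from the frame maximiser (cube lemma tight), and by HY21 Thm 4 the count is a parametric breakpoint number — Carstensen-type gadgets or root-of-unity designs might force (kmt)^ω(1).
sources: KoiranEtAl2014 Ex 3 + Prop 1, HrubesYehudayoff2021 Thm 4 + Lemma 28 + Prop 49 + Remark 48, doi:10.1006/jcss.2001.1766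
[crux] k-UNIFORM polynomial bound in the dissociated regime (card crux "k-uniform bound"): if supp
f_ij ⊆ A_j with |A_j| ≤ t and the sum map A_1 × ⋯ × A_m → ℕ² is injective (every point of the
potential support has a unique exponent tuple), then Newt(Σ_i Π_j f_ij) has ≤ (kmt+2)^C vertices.
Equivalently: the planar image of the support of a rank-≤k tensor in ⊗_j ℂ^(A_j) has poly(k,m,t)
hull vertices. [difficulty: open-problem] -/
@[route_item "route-ValiantsHypothesis-NewtonFrames"]
def DissociatedUniform : Prop :=
  ∃ C : ℕ, ∀ (k m t : ℕ) (A : Fin m → Finset (Fin 2 →₀ ℕ)) (f : Fin k → Fin m → MvPolynomial (Fin 2) ℂ), (∀ j, (A j).card ≤ t) → (∀ i j, (f i j).support ⊆ A j) → (∀ a b : Fin m → (Fin 2 →₀ ℕ), (∀ j, a j ∈ A j) → (∀ j, b j ∈ A j) → ∑ j, a j = ∑ j, b j → a = b) → (Set.extremePoints ℝ (convexHull ℝ ((fun e : Fin 2 →₀ ℕ => fun i : Fin 2 => ((e i : ℕ) : ℝ)) '' ((∑ i, ∏ j, f i j).support : Set (Fin 2 →₀ ℕ))))).ncard ≤ (k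 * m * t + 2) ^ C

/-- item stmt-ValiantsHypothesis-6690 · aside · rank 4 · open · by planner
why it might fail: Internal cancellation hollows a product for free ((1−X)(1+X+⋯+X^(t−2)) = 1−X^(t−1)): a product of t-sparse factors supported on 'hull vertices + a long convex chain one point deep', or a sparse Minkowski sum with (mtD)^ω(1) shallow points in convex position, refutes it.
sources: KoiranEtAl2014 §5 + Thms 5-6 + Appendix Thm 7, zbl:1160.52013, arXiv:1903.11287, zbl:1205.52010, TaoVu2006
[crux] Coincidence half, minimal form: ∃ c such that for ONE product T = Π_(j<m) g_j of t-sparse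
bivariate complex polynomials and every finite C ⊂ ℕ², conv(supp T ∖ C) has ≤ (m+t+|C|+2)^c
vertices. |C| = 0 is Ostrowski (≤ mt); C = {0} contains KPTT's open problems 'Newt(fg+1)' and
'Newt(f₁⋯f_m+1)' (best known t^(4/3), k·t^(2m/3)); generic coefficients make it pure geometry
(shallow points of a Minkowski sum in convex position); special coefficients make internal
cancellation = additive relations among the blocks the whole difficulty. It is the sub-case of
NewtonTau with k = |C|+1 products all but one of which are monomials. [difficulty: open-problem] -/
@[route_item "route-ValiantsHypothesis-NewtonFrames"]
def ProductMinusPoints : Prop :=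
  ∃ c : ℕ, ∀ (m t : ℕ) (g : Fin m → MvPolynomial (Fin 2) ℂ) (C : Finset (Fin 2 →₀ ℕ)), (∀ j, (g j).support.card ≤ t) → (Set.extremePoints ℝ (convexHull ℝ ((fun e : Fin 2 →₀ ℕ => fun l : Fin 2 => ((e l : ℕ) : ℝ)) '' (((∏ j, g j).support \ C : Finset (Fin 2 →₀ ℕ)) : Set (Fin 2 →₀ ℕ))))).ncard ≤ (m + t + C.card + 2) ^ c

-- earlier TwoProducts (stmt-ValiantsHypothesis-6691, replaced 2026-08-15T12:03:44Z -> stmt-ValiantsHypothesis-5906): retired by None — ∃ c : ℕ, ∀ (m t : ℕ) (f : Fin 2 → Fin m → MvPolynomial (Fin 2) ℂ), (∀ i j, (f i j).support.card ≤ t) → (Set.extremePoints ℝ (convexHull ℝ ((fun e : Fin 2 →₀ ℕ => fun l : Fin 2 => ((e l : ℕ) : ℝ)) '' ((∑ i, ∏ j, f i j).support : Set (Fin 2 →₀ ℕ))))).ncard ≤ (m + t + 2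
/-- item stmt-ValiantsHypothesis-5906 · aside · rank 5 · open · by planner
why it might fail: Open even for g ≡ 1 (KPTT §5: f₁⋯f_m+1; best k·t^(2m/3)); on non-aligned non-direct frames tensor and coincidence cancellation mix, each coefficient is a long fibre sum, and two signed products on Example-3 digit grids might carve t^Ω(m) of the t^(m/3) convexly independent candidates.
sources: KoiranEtAl2014 Thm 6 + Prop 1 + §5, HrubesYehudayoff2021 Open Problem 2, arXiv:1903.11287
[crux] two products with arbitrary (coinciding) exponents: Newt(Π_(j<m) f_j − Π_(j<m) g_j) has ≤
2^(a·m)(t+2)^b vertices for t-sparse f_j, g_j (X at k = 2; contains KPTT §5 open problems: fg+1 (m =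
2, known O(t^(4/3)), conjectured linear) and f_1⋯f_m + 1, and the card's R2 with binomial f_j). Here
a cancelled point is a vanishing sum over a whole FIBRE of the sum map, Σ_(a∈fibre) (Πc(a) − Πc'(a))
= 0. [difficulty: L] -/
@[route_item "route-ValiantsHypothesis-NewtonFrames"]
def TwoProducts : Prop :=
  ∃ a b : ℕ, ∀ (m t : ℕ) (f g : Fin m → MvPolynomial (Fin 2) ℂ), (∀ j, (f j).support.card ≤ t) → (∀ j, (g j).support.card ≤ t) → (Set.extremePoints ℝ (convexHull ℝ ((fun e : Fin 2 →₀ ℕ => fun i : Fin 2 => ((e i : ℕ) : ℝ)) '' ((∏ j, f j - ∏ j, g j).support : Set (Fin 2 →₀ ℕ))))).ncard ≤ 2 ^ (a * m) * (t + 2) ^ b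

/-- item stmt-ValiantsHypothesis-7365 · banked · rank 6 · closed · proved by Summit.ValiantsHypothesis.ValiantsHypothesis.Theorems.shallowChains_proof (prover) · by planner
why it might fail: A new vertex of S∖C only needs its tangent cap inside C: per direction C(m+D,D) rank profiles of candidates, superpolynomial when m≈D; a direct sum of m sparse sets with a convex chain of length (m+D)^ω(1) lying ≤ D points deep refutes it (grids give only D^(1/3)).
sources: zbl:1160.52013, zbl:1205.52010, arXiv:1903.11287, KoiranEtAl2014 Ex 3 + Lemma 2 + Prop 1, HrubesYehudayoff2021 Lemma 8
[crux] The coefficient-free core (card newton-polygon-freiman Lemma A, exact form): for t-sets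
A_0..A_(m-1) in N^2 with Minkowski sum S (image of the product under the sum map) and every finite
C, conv(S minus C) has <= (m+t+|C|+2)^c vertices; = ProductMinusPoints for generic coefficients; C
empty gives <= mt; content: shallow points of a Minkowski sum in convex position are few. why it
might fail: A new vertex p of S∖C only needs its tangent cap inside C: per direction there are
C(m+D,D) rank profiles of candidates, superpolynomial when m ≈ D; a direct sum of m sparse sets with
a convex chain of length (m+D)^ω(1) lying ≤ D points deep refutes it (grids give only D^(1/3)).
sources: zbl:1160.52013, zbl:1205.52010, arXiv:1903.11287, KoiranEtAl2014 Ex 3 + Lemma 2 + Prop 1,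
HrubesYehudayoff2021 Lemma 8 [difficulty: M] -/
@[route_item "route-ValiantsHypothesis-NewtonFrames"]
def ShallowChains : Prop :=
  ∃ c : ℕ, ∀ (m t : ℕ) (A : Fin m → Finset (Fin 2 →₀ ℕ)) (C : Finset (Fin 2 →₀ ℕ)), (∀ j, (A j).card ≤ t) → (Set.extremePoints ℝ (convexHull ℝ ((fun e : Fin 2 →₀ ℕ => fun i : Fin 2 => ((e i : ℕ) : ℝ)) '' ((((Fintype.piFinset A).image (fun a => ∑ j, a j)) \ C : Finset (Fin 2 →₀ ℕ)) : Set (Fin 2 →₀ ℕ))))).ncard ≤ (m + t + C.card + 2) ^ c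

-- `ShallowChains` holds: proved by `Summit.ValiantsHypothesis.ValiantsHypothesis.Theorems.shallowChains_proof` (its module imports this route file, so no `_holds` link can be stated here).

-- earlier Assembly (stmt-ValiantsHypothesis-6693, replaced 2026-08-15T12:03:44Z -> stmt-ValiantsHypothesis-5910): retired by None — (∃ c : ℕ, ∀ (k m t : ℕ) (f : Fin k → Fin m → MvPolynomial (Fin 2) ℂ), (∀ i j, (f i j).support.card ≤ t) → (Set.extremePoints ℝ (convexHull ℝ ((fun e : Fin 2 →₀ ℕ => fun l : Fin 2 => ((e l : ℕ) : ℝ)) '' ((∑ i, ∏ j, f i j).support : Set (Fin 2 →₀ ℕ))))).ncard ≤ (k + m + t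
/-- item stmt-ValiantsHypothesis-5910 · assembly · rank 1 · closed · proved by Summit.ValiantsHypothesis.Theorems.NewtonUnitEquations.Assembly_proof (prover) · by planner
sources: KoiranEtAl2014 Thm 1, Valiant1979, tree HubHub.lean
[assembly] NewtonTauWeak → KpttTransfer → ValiantsHypothesis (hub + mem_VP_ofFintype_iff_holds +
perFamily_mem_VNP_holds). -/
@[route_item "route-ValiantsHypothesis-NewtonFrames"]
def Assembly : Prop :=
  NewtonTauWeak → KpttTransfer → ValiantsHypothesis

/-- `Assembly` holds: proved by `Summit.ValiantsHypothesis.Theorems.NewtonUnitEquations.Assembly_proof`. -/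
theorem Assembly_holds : Assembly := _root_.Summit.ValiantsHypothesis.Theorems.NewtonUnitEquations.Assembly_proof

-- records of items no longer active in this route (dropped / restated):
-- earlier NewtonTau (stmt-ValiantsHypothesis-6687, replaced 2026-08-15T12:03:44Z -> stmt-ValiantsHypothesis-5904): retired by None — ∃ c : ℕ, ∀ (k m t : ℕ) (f : Fin k → Fin m → MvPolynomial (Fin 2) ℂ), (∀ i j, (f i j).support.card ≤ t) → (Set.extremePoints ℝ (convexHull ℝ ((fun e : Fin 2 →₀ ℕ => fun l : Fin 2 => ((e l : ℕ) : ℝ)) '' ((∑ i, ∏ j, f i j).support : Set (Fin 2 →₀ ℕ))))).ncard ≤ (k + m + t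
-- earlier DirectFrames (stmt-ValiantsHypothesis-6689, replaced 2026-08-15T12:03:44Z -> stmt-ValiantsHypothesis-5905): retired by None — ∃ c : ℕ, ∀ (k m t : ℕ) (A : Fin m → Finset (Fin 2 →₀ ℕ)) (f : Fin k → Fin m → MvPolynomial (Fin 2) ℂ), (∀ j, (A j).card ≤ t) → (∀ e e' : Fin m → (Fin 2 →₀ ℕ), (∀ j, e j ∈ A j) → (∀ j, e' j ∈ A j) → ∑ j, e j = ∑ j, e' j → e = e') → (∀ i j, (f i j).support ⊆ A j) → (S

/-! D-0027 §2.1 — DECIDING THEOREM (planner-authored via `route open/edit --closes-file`; by planner-rbadge-ValiantsHypothesis-NewtonFrames-8d017c56-g2-0 2026-08-15T16:15:40Z):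
its hypotheses are this route's items and its conclusion the sub-problem Statement (glue_lint), and it elaborates with this file. -/

/-- D-0027 §2.1 deciding result of route NewtonFrames. Only the target `NewtonTauWeak` (KPTT's weak
Newton-polygon τ-conjecture over `ℂ`) is load-bearing: KPTT 2015 Thm 1 is PROVED in the tree
(`KPTT.theorem1_holds` in `Literature/Computability/AlgebraicComplexity/NewtonPolygonTauTransfer.lean`, whose
hypothesis `KPTT.newtonTauWeak` is `NewtonTauWeak` verbatim, `newtonVertexCount` being an abbrev), so the target
puts `(per_n)_n` outside `VP_ℂ`; the renaming bridge `mem_VP_ofFintype_iff_holds` and Valiant's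
`perFamily_mem_VNP_holds ℂ` (`per ∈ VNP_ℂ`) then give `VP_ℂ ≠ VNP_ℂ`, exactly the bookkeeping of the hub lemma
`Summit.ValiantsHypothesis.Hub.valiantsHypothesis_of_not_isVPFamily_per`. The support item `KpttTransfer` and
the `Assembly` item are settled by the same Literature result and are deliberately not hypotheses here. -/
@[closes "route-ValiantsHypothesis-NewtonFrames"] theorem closes (h_NewtonTauWeak : NewtonTauWeak) : _root_.ValiantsHypothesis := by
  -- KPTT Thm 1 (proved transfer): the weak Newton-polygon bound puts the permanent family outside VP over ℂ
  have hW : Literature.Computability.AlgebraicComplexity.KPTT.newtonTauWeak := h_NewtonTauWeak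
  have hnot : ¬ Literature.Computability.AlgebraicComplexity.IsVPFamily
      (fun n => Literature.Computability.AlgebraicComplexity.perPoly (Fin n) ℂ) :=
    Literature.Computability.AlgebraicComplexity.KPTT.theorem1_holds hW
  -- hub bookkeeping: VP = VNP together with per ∈ VNP would make per a VP family
  show Literature.Computability.AlgebraicComplexity.VP ℂ ≠ Literature.Computability.AlgebraicComplexity.VNP ℂ
  intro hEq
  apply hnot
  have hVNP : Literature.Computability.AlgebraicComplexity.perFamily ℂ ∈
      Literature.Computability.AlgebraicComplexity.VNP ℂ :=
    Literature.Computability.AlgebraicComplexity.perFamily_mem_VNP_holds ℂ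
  have hVP : Literature.Computability.AlgebraicComplexity.perFamily ℂ ∈
      Literature.Computability.AlgebraicComplexity.VP ℂ := by
    rw [hEq]; exact hVNP
  exact (Literature.Computability.AlgebraicComplexity.mem_VP_ofFintype_iff_holds _).1 hVP

end Summit.ValiantsHypothesis.ValiantsHypothesis.Theses.NewtonFrames
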